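/-
Copyright (c) 2026. All rights reserved.
Released under Apache 2.0 license as described in the file LICENSE.
-/
import Summits.Schanuel.Schanuel.Theorems.ZilberEacRealFibreDominance
import HarnessLib

/-!
# Real-slope line × arbitrary plane curve II: zeros of the twisted curve function

HONEST FRAMING.  Second of three files on the split surfaces `W = {x₁ = a x₀ + b} × Z(P)`,
`a ∈ ℝ ∖ ℚ`, `P ∈ ℂ[y₀, y₁]` arbitrary, towards modest rungs of ZILBER'S EXPONENTIAL-ALGEBRAIC
CLOSEDNESS conjecture (cell `pub-schanuel`, seat 1, gen 11).  NOT Schanuel's conjecture (neither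
used nor implied; EAC ⇏ SC); `EC(3,2)` and Mantova–Masser's density question in general stay OPEN.

Main results (all from Mathlib + the proved kit; no hypotheses beyond `a ∉ ℚ` and a torus point):
* `exists_zero_near_of_near_param` — zeros of a jointly continuous family of entire functions
  persist under small changes of the parameter (minimum modulus; Hurwitz in a parameter).
* `rfLevelSet_eq_univ` — on the torus part of `Z(P)` the functional
  `ψ = log|y₁| - a log|y₀| - Re b` attains EVERY real value as soon as `Z(P)` has a torus point:
  the set of attained values is open (persistence) and closed (monomial domination + compactness)
  in `ℝ`.  This replaces the local analysis of the (possibly singular) curve at its punctures.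
* `exists_expPoint_realLine_prod_curve` — EXISTENCE: `P(e^z, e^{az+b}) = 0` has a solution
  (in print: Mantova–Masser, PLMS 129 (2024) Thm 1.2 for all of `ℂ² × ℂ²`; Gallinaro, Selecta 29
  (2023) Thm 8.8 for split varieties with dominant projection; the kernel proof here is new and
  elementary: level `ψ = 0` + Kronecker + window periodicity).
* `exists_rf_accumulation_family` — the input for the density file: infinitely many torus points of
  `Z(P)`, each the limit of the fibre coordinates of a sequence of exponential points of `W` whose
  base coordinate tends to infinity.
-/

noncomputable section

open Filter Topology Metric Set Complex Bornology
open Literature.NumberTheory.Transcendental Literature.ModelTheory.Zilber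
open Literature.ModelTheory.ExponentialFields

set_option linter.dupNamespace false

namespace Summit.Schanuel.Schanuel.Theorems

/-! ## Part A. Persistence of zeros under a change of parameter -/

section Persistence

/-- **Zero persistence** (Hurwitz in a parameter, via the minimum modulus): if `(u, ζ) ↦ Φ_u(ζ)`
is jointly continuous, each `Φ_u` is entire, `Φ_{u₀} ≢ 0` and `Φ_{u₀}(x₀) = 0`, then every `Φ_u`
with `u` close to `u₀` has a zero within `ε` of `x₀`. [folklore] -/
theorem exists_zero_near_of_near_param {Φ : ℂ → ℂ → ℂ}
    (hcont : Continuous fun p : ℂ × ℂ => Φ p.1 p.2) (hdiff : ∀ u, Differentiable ℂ (Φ u))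
    {u₀ x₀ : ℂ} (hne : ∃ z, Φ u₀ z ≠ 0) (hx₀ : Φ u₀ x₀ = 0) {ε : ℝ} (hε : 0 < ε) :
    ∃ δ > 0, ∀ u, ‖u - u₀‖ < δ → ∃ ζ, ‖ζ - x₀‖ < ε ∧ Φ u ζ = 0 := by
  obtain ⟨r, hr0, hrε, m, hm0, hm⟩ := exists_sphere_norm_le (hdiff u₀) hne x₀ hε
  set K : Set (ℂ × ℂ) := closedBall u₀ 1 ×ˢ sphere x₀ r with hK
  have hKc : IsCompact K := (isCompact_closedBall u₀ 1).prod (isCompact_sphere x₀ r)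
  obtain ⟨δ₁, hδ₁, h₁⟩ := Metric.uniformContinuousOn_iff.1
    (hKc.uniformContinuousOn_of_continuous hcont.continuousOn) (m / 2) (half_pos hm0)
  have hc2 : Continuous fun u => Φ u x₀ := hcont.comp (continuous_id.prodMk continuous_const)
  obtain ⟨δ₂, hδ₂, h₂⟩ := Metric.continuousAt_iff.1 hc2.continuousAt (m / 2) (half_pos hm0)
  refine ⟨min (min δ₁ δ₂) 1, by positivity, fun u hu => ?_⟩
  have hu1 : ‖u - u₀‖ < δ₁ := hu.trans_le ((min_le_left _ _).trans (min_le_left _ _))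
  have hu2 : ‖u - u₀‖ < δ₂ := hu.trans_le ((min_le_left _ _).trans (min_le_right _ _))
  have hu3 : ‖u - u₀‖ < 1 := hu.trans_le (min_le_right _ _)
  have hsphere : ∀ z ∈ sphere x₀ r, m / 2 ≤ ‖Φ u z‖ := by
    intro z hz
    have hzu : (u, z) ∈ K := ⟨mem_closedBall.2 (by rw [dist_eq_norm]; exact hu3.le), hz⟩
    have hzu₀ : (u₀, z) ∈ K := ⟨mem_closedBall_self zero_le_one, hz⟩
    have hd : dist (u, z) (u₀, z) < δ₁ := by
      rw [Prod.dist_eq, dist_self, dist_eq_norm, max_lt_iff]; exact ⟨hu1, hδ₁⟩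
    have h3 := h₁ (u, z) hzu (u₀, z) hzu₀ hd
    rw [dist_eq_norm] at h3
    have h4 := norm_sub_norm_le (Φ u₀ z) (Φ u z)
    rw [norm_sub_rev] at h4
    linarith [hm z hz]
  have hcentre : ‖Φ u x₀‖ < m / 2 := by
    have h3 := h₂ (by rw [dist_eq_norm]; exact hu2)
    rwa [hx₀, dist_zero_right] at h3
  obtain ⟨ζ, hζ, hζ0⟩ := exists_zero_of_norm_lt_of_sphere hr0 (lt_add_one r)
    (hdiff u).differentiableOn hsphere hcentre
  exact ⟨ζ, (by rw [← dist_eq_norm]; exact (mem_ball.1 hζ).trans_le hrε), hζ0⟩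

/-- **Zeros at far rotations**: under the hypotheses of `exists_zero_near_of_near_param` with
`|u₀| = 1` and `a ∉ ℚ`, there are rotations `e^{2πi n a}` with `|n|` arbitrarily large, arbitrarily
close to `u₀`, whose `Φ` has a zero arbitrarily close to `x₀` (Kronecker + persistence). (new) -/
theorem exists_zero_at_far_rotation {Φ : ℂ → ℂ → ℂ}
    (hcont : Continuous fun p : ℂ × ℂ => Φ p.1 p.2) (hdiff : ∀ u, Differentiable ℂ (Φ u))
    {a : ℝ} (ha : Irrational a) {u₀ x₀ : ℂ} (hu₀ : ‖u₀‖ = 1) (hne : ∃ z, Φ u₀ z ≠ 0)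
    (hx₀ : Φ u₀ x₀ = 0) {ε : ℝ} (hε : 0 < ε) (N : ℕ) :
    ∃ (n : ℤ) (ζ : ℂ), (N : ℝ) ≤ |(n : ℝ)| ∧ ‖urot (n * a) - u₀‖ < ε ∧ ‖ζ - x₀‖ < ε ∧
      Φ (urot (n * a)) ζ = 0 := by
  obtain ⟨δ, hδ, h⟩ := exists_zero_near_of_near_param hcont hdiff hne hx₀ hε
  obtain ⟨n, hn, hnu⟩ := exists_urot_near ha hu₀ (lt_min hδ hε) N
  obtain ⟨ζ, hζ, hζ0⟩ := h _ (hnu.trans_le (min_le_left _ _))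
  exact ⟨n, ζ, hn, hnu.trans_le (min_le_right _ _), hζ, hζ0⟩

end Persistence

/-! ## Part B. The level functional `ψ` attains every real value on the torus curve -/

section LevelSet

variable {a : ℝ} {b : ℂ} {P : MvPolynomial (Fin 2) ℂ}

/-- The set of values of `ψ = log|y₁| - a log|y₀| - Re b` on the torus points of `Z(P)`. (new) -/
def rfLevelSet (a : ℝ) (b : ℂ) (P : MvPolynomial (Fin 2) ℂ) : Set ℝ :=
  {θ | ∃ c : Fin 2 → ℂ, c 0 ≠ 0 ∧ c 1 ≠ 0 ∧ MvPolynomial.eval c P = 0 ∧ rfPsi a b c = θ}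

/-- `exp(-M) ≤ x ≤ exp M` from `|log x| ≤ M`, `x > 0`. -/
theorem rf_mem_Icc_of_abs_log_le {x M : ℝ} (hx : 0 < x) (h : |Real.log x| ≤ M) :
    x ∈ Icc (Real.exp (-M)) (Real.exp M) := by
  rw [abs_le] at h
  constructor
  · calc Real.exp (-M) ≤ Real.exp (Real.log x) := Real.exp_le_exp.2 h.1
      _ = x := Real.exp_log hx
  · calc x = Real.exp (Real.log x) := (Real.exp_log hx).symm
      _ ≤ Real.exp M := Real.exp_le_exp.2 h.2

/-- **Openness** of the set of attained levels (zero persistence in the parameter `u`). (new) -/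
theorem isOpen_rfLevelSet (ha : Irrational a) (b : ℂ) (hP : P ≠ 0) :
    IsOpen (rfLevelSet a b P) := by
  refine Metric.isOpen_iff.2 fun θ ⟨c, h0, h1, hc, hψ⟩ => ?_
  obtain ⟨u₀, x₀, hu₀, hpt, hlog⟩ := exists_rfPt_eq (a := a) (b := b) h0 h1
  have hx₀ : curveFn a b P u₀ x₀ = 0 := by simp only [curveFn, hpt, hc]
  obtain ⟨δ, hδ, hzero⟩ := exists_zero_near_of_near_param (continuous_curveFn a b P)
    (differentiable_curveFn a b P) (exists_curveFn_ne_zero ha b hP hu₀) hx₀ one_pos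
  set g : ℝ → ℂ := fun θ' => u₀ * ((Real.exp (θ' - θ) : ℝ) : ℂ) with hg
  have hgc : Continuous g := continuous_const.mul
    (Complex.continuous_ofReal.comp (Real.continuous_exp.comp (continuous_id.sub continuous_const)))
  have hgθ : g θ = u₀ := by simp [hg]
  obtain ⟨η, hη, hηδ⟩ := Metric.continuousAt_iff.1 hgc.continuousAt δ hδ
  refine ⟨η, hη, fun θ' hθ' => ?_⟩
  have hd : ‖g θ' - u₀‖ < δ := by rw [← dist_eq_norm, ← hgθ]; exact hηδ (mem_ball.1 hθ')
  obtain ⟨ζ, -, hζ⟩ := hzero (g θ') hd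
  have hg0 : g θ' ≠ 0 := mul_ne_zero hu₀ (by exact_mod_cast (Real.exp_pos _).ne')
  refine ⟨rfPt a b (g θ') ζ, rfPt_ne_zero a b hg0 ζ 0, rfPt_ne_zero a b hg0 ζ 1, hζ, ?_⟩
  rw [rfPsi_rfPt a b hg0, hg, norm_mul, Complex.norm_real, Real.norm_eq_abs,
    abs_of_pos (Real.exp_pos _), Real.log_mul (norm_ne_zero_iff.2 hu₀) (Real.exp_pos _).ne',
    Real.log_exp, hlog, hψ]
  ring

/-- **Closedness** of the set of attained levels (monomial domination keeps the torus points with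
bounded level inside a compact part of the torus). (new) -/
theorem isClosed_rfLevelSet (ha : Irrational a) (b : ℂ) (hP : P ≠ 0) :
    IsClosed (rfLevelSet a b P) := by
  refine IsSeqClosed.isClosed ?_
  intro θ t hθ ht
  have hθ' : ∀ k, ∃ c : Fin 2 → ℂ, c 0 ≠ 0 ∧ c 1 ≠ 0 ∧ MvPolynomial.eval c P = 0 ∧
      rfPsi a b c = θ k := hθ
  choose c h0 h1 hc hψ using hθ'
  obtain ⟨R, hR⟩ : ∃ R, ∀ k, |θ k| ≤ R := by
    obtain ⟨R, hR⟩ := (Metric.isBounded_range_of_tendsto θ ht).exists_norm_le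
    exact ⟨R, fun k => by simpa [Real.norm_eq_abs] using hR _ ⟨k, rfl⟩⟩
  obtain ⟨K, hK⟩ := abs_log_norm_le_of_eval_eq_zero ha hP (R + |b.re|)
  have hψ' : ∀ k, Real.log ‖c k 1‖ - a * Real.log ‖c k 0‖ = θ k + b.re := fun k => by
    have := hψ k; simp only [rfPsi] at this; linarith
  have hlog0 : ∀ k, |Real.log ‖c k 0‖| ≤ K := fun k =>
    hK (c k) (h0 k) (h1 k) (hc k)
      (by rw [hψ' k]; exact (abs_add_le _ _).trans (by linarith [hR k]))
  have hlog1 : ∀ k, |Real.log ‖c k 1‖| ≤ R + |b.re| + |a| * K := fun k => by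
    have e : Real.log ‖c k 1‖ = θ k + b.re + a * Real.log ‖c k 0‖ := by linarith [hψ' k]
    rw [e]
    refine (abs_add_three _ _ _).trans ?_
    rw [abs_mul]
    gcongr
    · exact hR k
    · exact hlog0 k
  set M := max K (R + |b.re| + |a| * K) with hM
  set A : Set (Fin 2 → ℂ) :=
    ⋂ i, (fun c : Fin 2 → ℂ => ‖c i‖) ⁻¹' Icc (Real.exp (-M)) (Real.exp M) with hA
  have hAc : IsCompact A := by
    refine Metric.isCompact_of_isClosed_isBounded
      (isClosed_iInter fun i => isClosed_Icc.preimage (continuous_apply i).norm)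
      ((Metric.isBounded_closedBall (x := (0 : Fin 2 → ℂ)) (r := Real.exp M)).subset
        fun c hc => ?_)
    rw [mem_closedBall_zero_iff, pi_norm_le_iff_of_nonneg (Real.exp_pos M).le]
    exact fun i => (Set.mem_iInter.1 hc i).2
  have hcA : ∀ k, c k ∈ A := fun k => by
    refine Set.mem_iInter.2 fun i => ?_
    fin_cases i
    · exact rf_mem_Icc_of_abs_log_le (norm_pos_iff.2 (h0 k)) ((hlog0 k).trans (le_max_left _ _))
    · exact rf_mem_Icc_of_abs_log_le (norm_pos_iff.2 (h1 k)) ((hlog1 k).trans (le_max_right _ _))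
  obtain ⟨c', hc'A, φ, hφ, hlim⟩ := hAc.tendsto_subseq hcA
  have hne : ∀ i, c' i ≠ 0 := fun i =>
    norm_pos_iff.1 ((Real.exp_pos _).trans_le (Set.mem_iInter.1 hc'A i).1)
  refine ⟨c', hne 0, hne 1, ?_, ?_⟩
  · have hl : Tendsto (fun k => MvPolynomial.eval (c (φ k)) P) atTop
        (𝓝 (MvPolynomial.eval c' P)) := ((MvPolynomial.continuous_eval P).tendsto c').comp hlim
    have e : (fun k => MvPolynomial.eval (c (φ k)) P) = fun _ => (0 : ℂ) := funext fun k => hc _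
    rw [e] at hl
    exact (tendsto_const_nhds_iff.1 hl).symm
  · have hl : Tendsto (fun k => rfPsi a b (c (φ k))) atTop (𝓝 (rfPsi a b c')) :=
      (continuousAt_rfPsi a b (hne 0) (hne 1)).tendsto.comp hlim
    have hl' : Tendsto (fun k => rfPsi a b (c (φ k))) atTop (𝓝 t) := by
      have e : (fun k => rfPsi a b (c (φ k))) = θ ∘ φ := funext fun k => hψ _
      rw [e]; exact ht.comp hφ.tendsto_atTop
    exact tendsto_nhds_unique hl hl'

/-- **Every level is attained**: `ℝ` is connected. (new) -/
theorem rfLevelSet_eq_univ (ha : Irrational a) (b : ℂ) (hP : P ≠ 0)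
    (hW : ∃ c : Fin 2 → ℂ, c 0 ≠ 0 ∧ c 1 ≠ 0 ∧ MvPolynomial.eval c P = 0) :
    rfLevelSet a b P = univ := by
  obtain ⟨c, h0, h1, hc⟩ := hW
  exact IsClopen.eq_univ ⟨isClosed_rfLevelSet ha b hP, isOpen_rfLevelSet ha b hP⟩
    ⟨rfPsi a b c, c, h0, h1, hc, rfl⟩

/-- **A unimodular zero**: some `Φ_u` with `|u| = 1` has a zero (level `ψ = 0`). (new) -/
theorem exists_unimodular_zero (ha : Irrational a) (b : ℂ) (hP : P ≠ 0)
    (hW : ∃ c : Fin 2 → ℂ, c 0 ≠ 0 ∧ c 1 ≠ 0 ∧ MvPolynomial.eval c P = 0) :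
    ∃ u x : ℂ, ‖u‖ = 1 ∧ curveFn a b P u x = 0 := by
  have h0 : (0 : ℝ) ∈ rfLevelSet a b P := by rw [rfLevelSet_eq_univ ha b hP hW]; trivial
  obtain ⟨c, h0, h1, hc, hψ⟩ := h0
  obtain ⟨u, x, hu, hpt, hlog⟩ := exists_rfPt_eq (a := a) (b := b) h0 h1
  refine ⟨u, x, ?_, by simp only [curveFn, hpt, hc]⟩
  have h := Real.exp_log (norm_pos_iff.2 hu)
  rwa [hlog, hψ, Real.exp_zero, eq_comm] at h

end LevelSet

/-! ## Part C. Exponential points: existence and accumulation -/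

section Accumulation

variable {a : ℝ} {b : ℂ} {P : MvPolynomial (Fin 2) ℂ}

/-- Two twisted fibre points with the same image and `ζ`'s closer than `2π` have the same
parameters. -/
theorem rfPt_eq_rfPt_imp {a : ℝ} {b u u' ζ ζ' : ℂ} (h : rfPt a b u ζ = rfPt a b u' ζ')
    (hζ : ‖ζ - ζ'‖ < 2 * Real.pi) : ζ = ζ' ∧ u = u' := by
  have h0 := congr_fun h 0
  have h1 := congr_fun h 1
  simp only [rfPt_zero, rfPt_one] at h0 h1
  obtain ⟨m, hm⟩ := Complex.exp_eq_exp_iff_exists_int.1 h0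
  have h2π : ‖(2 * Real.pi * I : ℂ)‖ = 2 * Real.pi := by simp [abs_of_pos Real.pi_pos]
  have hm0 : m = 0 := by
    have e : ‖ζ - ζ'‖ = |(m : ℝ)| * (2 * Real.pi) := by
      rw [hm, add_sub_cancel_left, norm_mul, Complex.norm_intCast, h2π]
    rw [e] at hζ
    have h3 : |(m : ℝ)| < 1 := by nlinarith [Real.pi_pos, abs_nonneg (m : ℝ)]
    have h4 : |m| < 1 := by exact_mod_cast h3
    exact Int.abs_lt_one_iff.1 h4
  rw [hm0, Int.cast_zero, zero_mul, add_zero] at hm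
  refine ⟨hm, ?_⟩
  rw [hm] at h1
  exact mul_right_cancel₀ (Complex.exp_ne_zero _) h1

/-- **Accumulation at a unimodular zero.** If `|u| = 1` and `Φ_u(x) = 0`, then `Φ_1` has zeros
`z_k` with `|z_k| → ∞` whose fibre points `(e^{z_k}, e^{a z_k + b})` converge to the torus point
`(e^x, u e^{ax+b})` of `Z(P)` (Kronecker + persistence + window periodicity). (new) -/
theorem exists_seq_zero_tendsto (ha : Irrational a) (b : ℂ) (hP : P ≠ 0) {u x : ℂ}
    (hu : ‖u‖ = 1) (hx : curveFn a b P u x = 0) :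
    ∃ z : ℕ → ℂ, (∀ k, curveFn a b P 1 (z k) = 0) ∧ Tendsto (fun k => ‖z k‖) atTop atTop ∧
      Tendsto (fun k => rfPt a b 1 (z k)) atTop (𝓝 (rfPt a b u x)) := by
  have hu0 : u ≠ 0 := norm_pos_iff.1 (by rw [hu]; exact one_pos)
  have key : ∀ k : ℕ, ∃ (n : ℤ) (ζ : ℂ), (k : ℝ) ≤ |(n : ℝ)| ∧
      ‖urot (n * a) - u‖ < 1 / ((k : ℝ) + 1) ∧ ‖ζ - x‖ < 1 / ((k : ℝ) + 1) ∧
      curveFn a b P (urot (n * a)) ζ = 0 := fun k =>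
    exists_zero_at_far_rotation (continuous_curveFn a b P) (differentiable_curveFn a b P) ha hu
      (exists_curveFn_ne_zero ha b hP hu0) hx Nat.one_div_pos_of_nat k
  choose n ζ hn hnu hζ hzero using key
  have h2π : ‖(2 * Real.pi * I : ℂ)‖ = 2 * Real.pi := by simp [abs_of_pos Real.pi_pos]
  have hU : Tendsto (fun k => urot (n k * a)) atTop (𝓝 u) :=
    tendsto_iff_norm_sub_tendsto_zero.2 (squeeze_zero (fun k => norm_nonneg _)
      (fun k => (hnu k).le) tendsto_one_div_add_atTop_nhds_zero_nat)
  have hZ : Tendsto ζ atTop (𝓝 x) :=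
    tendsto_iff_norm_sub_tendsto_zero.2 (squeeze_zero (fun k => norm_nonneg _)
      (fun k => (hζ k).le) tendsto_one_div_add_atTop_nhds_zero_nat)
  refine ⟨fun k => ζ k + n k * (2 * Real.pi * I), fun k => ?_, ?_, ?_⟩
  · rw [curveFn_add_int_mul, one_mul]; exact hzero k
  · have hlow : ∀ k : ℕ, 2 * Real.pi * (k : ℝ) + -(‖x‖ + 1) ≤ ‖ζ k + n k * (2 * Real.pi * I)‖ := by
      intro k
      have h1 : ‖(n k : ℂ) * (2 * Real.pi * I)‖ = |(n k : ℝ)| * (2 * Real.pi) := by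
        rw [norm_mul, Complex.norm_intCast, h2π]
      have h1k : 1 / ((k : ℝ) + 1) ≤ 1 := by
        rw [div_le_one (by positivity)]; linarith [(Nat.cast_nonneg k : (0 : ℝ) ≤ k)]
      have h2 : ‖ζ k‖ ≤ ‖x‖ + 1 := by
        have := norm_add_le (ζ k - x) x
        rw [sub_add_cancel] at this
        linarith [hζ k]
      have h3 : ‖(n k : ℂ) * (2 * Real.pi * I)‖ ≤ ‖ζ k + n k * (2 * Real.pi * I)‖ + ‖ζ k‖ := by
        have := norm_sub_le (ζ k + n k * (2 * Real.pi * I)) (ζ k)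
        rwa [add_sub_cancel_left] at this
      rw [h1] at h3
      have h4 : 2 * Real.pi * (k : ℝ) ≤ |(n k : ℝ)| * (2 * Real.pi) := by
        have := mul_le_mul_of_nonneg_left (hn k) (by positivity : (0 : ℝ) ≤ 2 * Real.pi)
        linarith
      linarith
    have hlim : Tendsto (fun k : ℕ => 2 * Real.pi * (k : ℝ) + -(‖x‖ + 1)) atTop atTop :=
      tendsto_atTop_add_const_right _ _
        (Tendsto.const_mul_atTop (by positivity) tendsto_natCast_atTop_atTop)
    exact tendsto_atTop_mono hlow hlim
  · have e : (fun k => rfPt a b 1 (ζ k + n k * (2 * Real.pi * I))) =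
        fun k => rfPt a b (urot (n k * a)) (ζ k) := funext fun k => by
      rw [rfPt_add_int_mul, one_mul]
    show Tendsto (fun k => rfPt a b 1 (ζ k + n k * (2 * Real.pi * I))) atTop (𝓝 (rfPt a b u x))
    rw [e]
    exact ((continuous_rfPt a b).tendsto (u, x)).comp (hU.prodMk_nhds hZ)

/-- **Existence of exponential points** on `{x₁ = a x₀ + b} × Z(P)`, `a ∈ ℝ ∖ ℚ`, for every
`P ∈ ℂ[y₀, y₁]` whose zero set meets the torus `(ℂˣ)²`: `P(e^z, e^{az+b}) = 0` is solvable.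
IN PRINT (Mantova–Masser 2024 Thm 1.2; Gallinaro 2023 Thm 8.8); new kernel proof.  A modest rung of
EAC; NOT Schanuel's conjecture. -/
theorem exists_expPoint_realLine_prod_curve (ha : Irrational a) (b : ℂ)
    (P : MvPolynomial (Fin 2) ℂ)
    (hW : ∃ c : Fin 2 → ℂ, c 0 ≠ 0 ∧ c 1 ≠ 0 ∧ MvPolynomial.eval c P = 0) :
    ∃ z : ℂ, MvPolynomial.eval ![exp z, exp ((a : ℂ) * z + b)] P = 0 := by
  by_cases hP : P = 0
  · exact ⟨0, by simp [hP]⟩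
  obtain ⟨u, x, hu, hx⟩ := exists_unimodular_zero ha b hP hW
  obtain ⟨z, hz, -, -⟩ := exists_seq_zero_tendsto ha b hP hu hx
  refine ⟨z 0, ?_⟩
  have h := hz 0
  have e : rfPt a b 1 (z 0) = ![exp (z 0), exp ((a : ℂ) * z 0 + b)] := by
    funext i; fin_cases i <;> simp [rfPt]
  rwa [curveFn, e] at h

/-- **Accumulation family.** For `P ≠ 0` with a torus point there are infinitely many (pairwise
distinct, uniformly bounded) torus points `c_i` of `Z(P)`, each the limit of the fibre points
`(e^{z_k}, e^{a z_k + b})` of a sequence of exponential points of `W` with `|z_k| → ∞`. (new) -/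
theorem exists_rf_accumulation_family (ha : Irrational a) (b : ℂ) (hP : P ≠ 0)
    (hW : ∃ c : Fin 2 → ℂ, c 0 ≠ 0 ∧ c 1 ≠ 0 ∧ MvPolynomial.eval c P = 0) :
    ∃ (c : ℕ → Fin 2 → ℂ) (B : ℝ), Function.Injective c ∧ (∀ i j, ‖c i j‖ ≤ B) ∧
      ∀ i, ∃ z : ℕ → ℂ, (∀ k, curveFn a b P 1 (z k) = 0) ∧
        Tendsto (fun k => ‖z k‖) atTop atTop ∧
        Tendsto (fun k => rfPt a b 1 (z k)) atTop (𝓝 (c i)) := by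
  obtain ⟨u₀, x₀, hu₀, hx₀⟩ := exists_unimodular_zero ha b hP hW
  have hu₀0 : u₀ ≠ 0 := norm_pos_iff.1 (by rw [hu₀]; exact one_pos)
  obtain ⟨δ, hδ, hzero⟩ := exists_zero_near_of_near_param (continuous_curveFn a b P)
    (differentiable_curveFn a b P) (exists_curveFn_ne_zero ha b hP hu₀0) hx₀ one_pos
  -- infinitely many rotations `e^{2πi n a}` within `δ` of `1`
  set U : Set ℤ := {n | ‖urot (n * a) - 1‖ < δ} with hU
  have hUinf : U.Infinite := by
    intro hfin
    obtain ⟨M, hM⟩ := (hfin.image fun n : ℤ => |(n : ℝ)|).bddAbove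
    obtain ⟨n, hn, hnu⟩ := exists_urot_near ha (u := 1) (by simp) hδ (⌈M⌉₊ + 1)
    have h1 : |(n : ℝ)| ≤ M := hM ⟨n, hnu, rfl⟩
    have h2 : (M : ℝ) < ⌈M⌉₊ + 1 := (Nat.le_ceil M).trans_lt (lt_add_one _)
    push_cast at hn
    linarith
  set e := hUinf.natEmbedding U with he
  have hui : ∀ i : ℕ, ‖u₀ * urot (((e i : ℤ) : ℝ) * a) - u₀‖ < δ := fun i => by
    rw [← mul_sub_one, norm_mul, hu₀, one_mul]; exact (e i).2
  choose ζ hζ hζ0 using fun i => hzero _ (hui i)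
  -- the family and its bound
  have hKc : IsCompact
      ((fun p : ℂ × ℂ => rfPt a b p.1 p.2) '' (closedBall u₀ δ ×ˢ closedBall x₀ 1)) :=
    ((isCompact_closedBall u₀ δ).prod (isCompact_closedBall x₀ 1)).image (continuous_rfPt a b)
  obtain ⟨B, hB⟩ := hKc.isBounded.exists_norm_le
  refine ⟨fun i => rfPt a b (u₀ * urot (((e i : ℤ) : ℝ) * a)) (ζ i), B, ?_, ?_, ?_⟩
  · intro i j hij
    have hzz : ‖ζ i - ζ j‖ < 2 * Real.pi := by
      have h1 := norm_sub_le (ζ i - x₀) (ζ j - x₀)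
      rw [sub_sub_sub_cancel_right] at h1
      linarith [hζ i, hζ j, Real.pi_gt_three]
    have h2 := (rfPt_eq_rfPt_imp hij hzz).2
    have h3 : urot (((e i : ℤ) : ℝ) * a) = urot (((e j : ℤ) : ℝ) * a) := mul_left_cancel₀ hu₀0 h2
    exact e.injective (Subtype.ext (urot_int_mul_injective ha h3))
  · intro i j
    refine (norm_le_pi_norm _ j).trans
      (hB _ ⟨(u₀ * urot (((e i : ℤ) : ℝ) * a), ζ i), ⟨?_, ?_⟩, rfl⟩)
    · exact mem_closedBall.2 (by rw [dist_eq_norm]; exact (hui i).le)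
    · exact mem_closedBall.2 (by rw [dist_eq_norm]; exact (hζ i).le)
  · intro i
    exact exists_seq_zero_tendsto ha b hP (by rw [norm_mul, hu₀, norm_urot, one_mul]) (hζ0 i)

end Accumulation

end Summit.Schanuel.Schanuel.Theorems
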